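import Summits.HodgeConjecture.HodgeConjecture.Theorems.Ring2HypothesesDescentAbsoluteTannakaPricing
import HarnessLib

/-!
# Ring 2 — hypotheses layer, descent axis: THE INVARIANTS OF THE ABSOLUTE HODGE STABILISER — Principle A in invariant form
# and the absolute-Hodge invariants principle on the powers are THEOREMS for abelian varieties modulo c1 (the asymmetry with (P2))

HONEST FRAMING (page 1, verbatim the cell's standing line): **research route conditional on HC_CM; not a
corollary; Q11.4-sentence-2 already refuted in dim ≥ 3.** Nothing in this file proves a case of the Hodge conjecture;
nothing discharges the binder of record b06 `Ring2.Hypotheses.AbsoluteHodgeImpliesAlgebraicAV` (`Ring2HypothesesDescent.lean` :73;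
OPEN); the binder table's numbers do not move. `HC_CM` (`Theses.RankFourFaces.CMAbelianHodge`) and `HC_AV` do not occur in this
file. Hodge ladder STAGE 3, `BINDER-OWNERS.md` row **b06**, seat `ring2-b06` (gen 81), second file; companion of
`Ring2HypothesesDescentAbsoluteTannakaPricing` (same gen: the absolute Hodge stabiliser
`G¹_AH(X)(ℂ) = powClassStabilizer X (absolute Hodge classes on the powers)`, INLINE; `Hg ≤ G¹_AH ≤ G¹_mot ≤ G¹_alg`;
`G¹_AH(A) = Hg(A)` mod c1; `ROW ⟺ [∀ A, G¹_alg(A) ≤ G¹_AH(A)]` granted typer 2's package (P2)).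

THE POINT. The companion priced row b06 against typer 2's HYPOTHESIS NODE (P2) `AlgebraicInvariantsPrincipleAV` («a rational
system of classes on the powers of `A` fixed by `G¹_alg(A)(ℂ)` is algebraic» — Tannaka duality for `⟨h(A)⟩ ⊂ Mot_hom`, in print
as a composite, never asserted) and recorded that the converse of `G¹_AH(A) = Hg(A)` needs «Principle A in invariant form»,
displayed there as an explicit hypothesis. THIS FILE shows that ON ABELIAN VARIETIES THE ABSOLUTE-HODGE SIDE OF THE DICTIONARY
IS COMPLETE MODULO c1 ALONE: the Hodge group of the tree has enough elements (the Deligne torus / van Geemen's Thm. 6.6, PROVED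
on the carriers by typer 2's part XXXVI-A `Ring2HypothesesDeligneTorus`: the rational `Hg(X)`-invariants of `H²ᵖ(X)` are exactly
the rational `(p,p)`-classes), so once `G¹_AH(A) = Hg(A)` (c1) every rational invariant of `G¹_AH(A)` is a Hodge class, hence
(c1 again) absolute Hodge:

* §I1 PRINCIPLE A IN INVARIANT FORM, for every `X` all of whose powers satisfy Charles–Schnell 11.2.17 (FACT-FREE), and for
  every complex abelian variety (mod c1): **a rational class of `H²ᵖ(A(ℂ); ℂ)` fixed by every element of `G¹_AH(A)(ℂ)` is
  absolute Hodge** (`isAbsoluteHodgeClass_of_forall_absoluteHodgeStabilizer_apply_eq_abelianVariety_of_deligne`) — Deligne I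
  Thm. 3.8 with `(tᵢ)` = all absolute Hodge classes on the powers, here a CONSEQUENCE of Main Thm. 2.11 (in Deligne's proof it is
  an INPUT; no circularity is claimed to be resolved — c1 stays a named fact of record); hence **the rational invariants of
  `G¹_AH(A)` in `H²ᵖ(A)` are EXACTLY the absolute Hodge classes** (`rational_invariants_absoluteHodgeStabilizer_eq_abelianVariety_of_deligne`).
* §I2 THE ABSOLUTE-HODGE INVARIANTS PRINCIPLE ON THE POWERS — the twin of (P2) with «algebraic» replaced by «absolute Hodge»:
  **every RATIONAL system of classes on the powers of `A` whose stabiliser contains `G¹_AH(A)(ℂ)` consists of absolute Hodge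
  classes — a THEOREM mod c1** (`absoluteHodgeInvariantsPrincipleAV_of_deligne`; general `X` under 11.2.17 on the powers:
  `…_of_forall_hodgeClassesAreAbsoluteHodgeFor`, fact-free). ASYMMETRY OF RECORD: on the absolute Hodge side both halves of the
  Tannakian dictionary (group `= Hg`, invariants `=` the classes) hold mod c1; on the algebraic side the group equality
  `G¹_alg = Hg` is `HC` on the powers (typer 2) and the invariants half is the open package (P2) (ON-PATH: ⟸ `HC_AV`).
* §I3 CONSEQUENCE FOR THE PRICE: mod c1, «(P2) restricted to systems fixed by `G¹_AH(A)`» is free, so in the companion's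
  `ROW ⟺ (P2) ∧ [∀ A, G¹_alg ≤ G¹_AH]` the package is only ever USED on systems that are already absolute Hodge: **mod c1,
  ROW ⟺ ∀ A, every rational system on the powers of `A` fixed by `G¹_alg(A)(ℂ)` is algebraic ON THE ABSOLUTE HODGE CLASSES IT
  CONTAINS** is NOT claimed (it would be (P2) again); what IS recorded: `ROW ∧ c1 ⟹` every rational `G¹_alg(A)`-fixed system is
  absolute Hodge AND algebraic (`algebraic_of_rational_system_of_algebraicStabilizer_le_of_deligne_of_row`).

HONEST COLUMN. Nothing is discharged; «10 · 0» unchanged; the row occurs once, as a HYPOTHESIS (§I3); (P2) is not used; c1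
`deligne1982_hodgeClasses_abelianVariety_absoluteHodge` is displayed in every abelian statement and nothing else is; no definition,
no new named fact, no sorry. NOT obtained: Principle A for a general smooth projective `X` (only under 11.2.17 on all powers of
`X`, which for non-abelian `X` is open); the torsor proof itself (multiplicativity of conjugation on the carriers is absent).

PRESEARCH: as in the companion (DM LNM 900 p0014 L1, p0043 L1 (I Thm. 3.8), p0059 L1; van Geemen 6.6–6.7 = typer 2's XXXVI-A on the
carriers); no statement of the asymmetry in print beyond Deligne–Milne II 6.25–6.26 («`H_σ` restricted to `M^{av}` is fully
faithful» = the absolute side) versus the standard-conjecture caveats for `Mot_hom`; certification by assembly; no novelty claimed.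
References (bib keys): Deligne1982HodgeCycles (I Prop. 3.4, Thm. 3.8; Main Thm. 2.11), DeligneMilne1982Tannakian (II Thm. 6.25,
Prop. 6.26), vanGeemen1994HodgeAV (Thm. 6.6, 6.7), FloccariFu2026 (§5 proof of Lemma 5.4), CharlesSchnell2014Notes (§11.2.5 (11.2.17)).
-/

noncomputable section

set_option linter.dupNamespace false

open CategoryTheory AlgebraicGeometry MonoidalCategory CartesianMonoidalCategory
open Literature.AlgebraicTopology.SingularHomology
open Literature.AlgebraicGeometry Literature.AlgebraicGeometry.Motives
open Literature.AlgebraicGeometry.HodgeTheory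

namespace Summit.HodgeConjecture.HodgeConjecture.Ring2.Hypotheses

/-! ## §I1 Principle A in invariant form: under 11.2.17 on the powers (fact-free), and for abelian varieties (mod c1) -/

section PrincipleA

variable {n : ℕ} {X : SchemeOver ℂ}

/-- **Principle A in invariant form under 11.2.17 on the powers — FACT-FREE**: if the Hodge classes of every power of the smooth
projective `X` are absolute Hodge, then every RATIONAL class of `H²ᵖ(X(ℂ); ℂ)` fixed by every element of `G¹_AH(X)(ℂ)` is absolute
Hodge. Proof: `G¹_AH(X) = Hg(X)` (companion), the rational `Hg(X)`-invariants are the rational `(p,p)`-classes (van Geemen 6.6 on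
the carriers, typer 2's `hodgePowClasses_zero_eq_rational_invariants`), and 11.2.17 for `X = X^{×1}`.
[cite: Deligne1982HodgeCycles, I Thm. 3.8 and Prop. 3.4] [cite: vanGeemen1994HodgeAV, Thm. 6.6 and 6.7] -/
theorem isAbsoluteHodgeClass_of_forall_absoluteHodgeStabilizer_apply_eq_of_forall_hodgeClassesAreAbsoluteHodgeFor
    (hX : IsSmoothProjective n X)
    (h : ∀ a : ℕ, HodgeClassesAreAbsoluteHodgeFor (cartesianPowDim n a) (cartesianPow X (a + 1)))
    {p : ℕ} {c : complexBetti X (2 * p)} (hc : IsRationalClass c)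
    (hfix : ∀ g ∈ powClassStabilizer X (fun a p ↦ {c : complexBetti (cartesianPow X (a + 1)) (2 * p) |
      IsAbsoluteHodgeClass (cartesianPowDim n a) (cartesianPow X (a + 1)) p c}), g (2 * p) c = c) :
    IsAbsoluteHodgeClass n X p c := by
  rw [absoluteHodgeStabilizer_eq_hodgeGroup_of_forall_hodgeClassesAreAbsoluteHodgeFor h] at hfix
  have hc' : c ∈ hodgePowClasses n X 0 p := by
    rw [hodgePowClasses_zero_eq_rational_invariants hX p]
    exact ⟨hc, hfix⟩
  exact (h 0).2 p c hc'.1 hc'.2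

/-- **PRINCIPLE A IN INVARIANT FORM FOR ABELIAN VARIETIES (mod c1): a rational class of `H²ᵖ(A(ℂ); ℂ)` fixed by every element of
`G¹_AH(A)(ℂ)` — the common stabiliser of all absolute Hodge classes on all powers of `A` — is absolute Hodge.** Deligne I
Thm. 3.8 («if `t` … is fixed by `G`, then it is an absolute Hodge cycle») with `(tᵢ)` = all absolute Hodge classes on the
powers, obtained here from Main Thm. 2.11 (c1, displayed; the powers `A^{×(a+1)}` are abelian varieties) and the Deligne torus —
in print 3.8 is an INPUT of 2.11; no circularity is resolved, c1 stays a named fact. [cite: Deligne1982HodgeCycles, I Thm. 3.8 and Main Thm. 2.11]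
[cite: vanGeemen1994HodgeAV, Thm. 6.6 and 6.7] -/
theorem isAbsoluteHodgeClass_of_forall_absoluteHodgeStabilizer_apply_eq_abelianVariety_of_deligne
    (hD : deligne1982_hodgeClasses_abelianVariety_absoluteHodge) (A : AbelianVariety ℂ)
    {p : ℕ} {c : complexBetti A.X (2 * p)} (hc : IsRationalClass c)
    (hfix : ∀ g ∈ powClassStabilizer A.X (fun a p ↦ {c : complexBetti (cartesianPow A.X (a + 1)) (2 * p) |
      IsAbsoluteHodgeClass (cartesianPowDim A.dim a) (cartesianPow A.X (a + 1)) p c}), g (2 * p) c = c) :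
    IsAbsoluteHodgeClass A.dim A.X p c :=
  isAbsoluteHodgeClass_of_forall_absoluteHodgeStabilizer_apply_eq_of_forall_hodgeClassesAreAbsoluteHodgeFor
    AbelianVariety.isSmoothProjective_holds (hodgeClassesAreAbsoluteHodgeFor_cartesianPow_abelianVariety_of_deligne hD A)
    hc hfix

/-- **The rational invariants of `G¹_AH(A)(ℂ)` in `H²ᵖ(A(ℂ); ℂ)` are EXACTLY the absolute Hodge classes** (mod c1): `⊇` is
definitional (an element of the stabiliser fixes the classes of the system on `A = A^{×1}`, `apply_eq_self_of_mem_powClassStabilizer`;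
absolute Hodge classes are rational), `⊆` is Principle A in invariant form. The absolute-Hodge twin of van Geemen's
`Bᵖ(A) = H²ᵖ(A, ℚ)^{Hg}` (typer 2's `hodgePowClasses_zero_eq_rational_invariants`). [cite: Deligne1982HodgeCycles, I Thm. 3.8 and Prop. 3.4]
[cite: vanGeemen1994HodgeAV, Thm. 6.6 and 6.7] -/
theorem rational_invariants_absoluteHodgeStabilizer_eq_abelianVariety_of_deligne
    (hD : deligne1982_hodgeClasses_abelianVariety_absoluteHodge) (A : AbelianVariety ℂ) (p : ℕ) :
    {c : complexBetti A.X (2 * p) | IsRationalClass c ∧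
      ∀ g ∈ powClassStabilizer A.X (fun a p ↦ {c : complexBetti (cartesianPow A.X (a + 1)) (2 * p) |
        IsAbsoluteHodgeClass (cartesianPowDim A.dim a) (cartesianPow A.X (a + 1)) p c}), g (2 * p) c = c} =
    {c : complexBetti A.X (2 * p) | IsAbsoluteHodgeClass A.dim A.X p c} := by
  ext c
  refine ⟨fun hc ↦ isAbsoluteHodgeClass_of_forall_absoluteHodgeStabilizer_apply_eq_abelianVariety_of_deligne hD A hc.1 hc.2,
    fun hc ↦ ⟨?_, fun g hg ↦ apply_eq_self_of_mem_powClassStabilizer hg (p := p) ?_⟩⟩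
  · exact IsAbsoluteHodgeClass.isRationalClass hc
  · exact hc

end PrincipleA

/-! ## §I2 The absolute-Hodge invariants principle on the powers — the twin of (P2) — is a theorem mod c1 -/

section Invariants

variable {n : ℕ} {X : SchemeOver ℂ}

/-- **Under 11.2.17 on the powers (FACT-FREE): every RATIONAL system of classes on the powers of `X` whose stabiliser contains
`G¹_AH(X)(ℂ)` consists of absolute Hodge classes.** `G¹_AH(X) = Hg(X)` (companion) `≤ Stab(S)`, so `S` consists of rational
`(p,p)`-classes power by power (typer 2's `hodgeGroup_le_powClassStabilizer_iff`, the Deligne torus on every power), hence of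
absolute Hodge classes by 11.2.17 there. [cite: vanGeemen1994HodgeAV, Thm. 6.6] [cite: Deligne1982HodgeCycles, I Prop. 3.4 and Thm. 3.8] -/
theorem absoluteHodgeInvariantsPrinciple_of_forall_hodgeClassesAreAbsoluteHodgeFor (hX : IsSmoothProjective n X)
    (h : ∀ a : ℕ, HodgeClassesAreAbsoluteHodgeFor (cartesianPowDim n a) (cartesianPow X (a + 1)))
    {S : ∀ a p : ℕ, Set (complexBetti (cartesianPow X (a + 1)) (2 * p))} (hS : ∀ a p, ∀ c ∈ S a p, IsRationalClass c)
    (hle : powClassStabilizer X (fun a p ↦ {c : complexBetti (cartesianPow X (a + 1)) (2 * p) |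
      IsAbsoluteHodgeClass (cartesianPowDim n a) (cartesianPow X (a + 1)) p c}) ≤ powClassStabilizer X S)
    (a p : ℕ) :
    S a p ⊆ {c : complexBetti (cartesianPow X (a + 1)) (2 * p) |
      IsAbsoluteHodgeClass (cartesianPowDim n a) (cartesianPow X (a + 1)) p c} := by
  rw [absoluteHodgeStabilizer_eq_hodgeGroup_of_forall_hodgeClassesAreAbsoluteHodgeFor h] at hle
  intro c hc
  obtain ⟨hcQ, hcH⟩ := (hodgeGroup_le_powClassStabilizer_iff hX hS).1 hle a p hc
  exact (h a).2 p c hcQ hcH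

/-- **THE ABSOLUTE-HODGE INVARIANTS PRINCIPLE FOR ABELIAN VARIETIES — a THEOREM mod c1**: for every complex abelian variety `A`
and every system `S` of RATIONAL classes on the powers of `A`, if every element of `G¹_AH(A)(ℂ)` fixes `S`, then `S` consists of
absolute Hodge classes. This is the statement of typer 2's hypothesis node (P2) `AlgebraicInvariantsPrincipleAV` with «algebraic»
replaced by «absolute Hodge» on both sides — and, unlike (P2), it is PROVED (mod c1): Deligne–Milne's «`H_σ` restricted to
`M^{av}_k` is fully faithful» (II 6.25–6.26) read as «invariants of `G^{AH}(A)` = absolute Hodge classes» on the tree's carriers.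
[cite: DeligneMilne1982Tannakian, II §6 Thm. 6.25 and Prop. 6.26] [cite: Deligne1982HodgeCycles, I Thm. 3.8 and Main Thm. 2.11]
[cite: vanGeemen1994HodgeAV, Thm. 6.6] -/
theorem absoluteHodgeInvariantsPrincipleAV_of_deligne (hD : deligne1982_hodgeClasses_abelianVariety_absoluteHodge)
    (A : AbelianVariety ℂ) {S : ∀ a p : ℕ, Set (complexBetti (cartesianPow A.X (a + 1)) (2 * p))}
    (hS : ∀ a p, ∀ c ∈ S a p, IsRationalClass c)
    (hle : powClassStabilizer A.X (fun a p ↦ {c : complexBetti (cartesianPow A.X (a + 1)) (2 * p) |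
      IsAbsoluteHodgeClass (cartesianPowDim A.dim a) (cartesianPow A.X (a + 1)) p c}) ≤ powClassStabilizer A.X S)
    (a p : ℕ) :
    S a p ⊆ {c : complexBetti (cartesianPow A.X (a + 1)) (2 * p) |
      IsAbsoluteHodgeClass (cartesianPowDim A.dim a) (cartesianPow A.X (a + 1)) p c} :=
  absoluteHodgeInvariantsPrinciple_of_forall_hodgeClassesAreAbsoluteHodgeFor AbelianVariety.isSmoothProjective_holds
    (hodgeClassesAreAbsoluteHodgeFor_cartesianPow_abelianVariety_of_deligne hD A) hS hle a p

/-- **… in particular every rational system fixed by the LARGER group `G¹_alg(A)(ℂ) ≥ G¹_AH(A)(ℂ)` — the systems to which (P2)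
applies — already consists of absolute Hodge classes** (mod c1 + V-B3 for `G¹_AH ≤ G¹_alg`): in the companion's price
`ROW ⟺ (P2) ∧ [∀ A, G¹_alg(A) ≤ G¹_AH(A)]` the package (P2) is only ever invoked on absolute Hodge systems.
[cite: FloccariFu2026, §5 proof of Lemma 5.4 (p. 13)] [cite: Deligne1982HodgeCycles, §2 Example 2.1 (a) and Main Thm. 2.11] -/
theorem absoluteHodge_of_rational_system_of_algebraicStabilizer_le_of_deligne
    (hD : deligne1982_hodgeClasses_abelianVariety_absoluteHodge) (hZ : deligne1982_cycleClass_absoluteHodge)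
    (A : AbelianVariety ℂ) {S : ∀ a p : ℕ, Set (complexBetti (cartesianPow A.X (a + 1)) (2 * p))}
    (hS : ∀ a p, ∀ c ∈ S a p, IsRationalClass c) (hle : algebraicStabilizer A.X ≤ powClassStabilizer A.X S) (a p : ℕ) :
    S a p ⊆ {c : complexBetti (cartesianPow A.X (a + 1)) (2 * p) |
      IsAbsoluteHodgeClass (cartesianPowDim A.dim a) (cartesianPow A.X (a + 1)) p c} :=
  absoluteHodgeInvariantsPrincipleAV_of_deligne hD A hS
    ((absoluteHodgeStabilizer_le_algebraicStabilizer hZ AbelianVariety.isSmoothProjective_holds).trans hle) a p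

end Invariants

/-! ## §I3 Consequence: under the row, rational `G¹_alg(A)`-fixed systems are absolute Hodge and algebraic -/

section Row

/-- **ROW b06 (a HYPOTHESIS) ∧ c1 ⟹ every rational system on the powers of `A` fixed by `G¹_alg(A)(ℂ)` is algebraic** — i.e. the
conclusion of (P2) — WITHOUT (P2): such a system is absolute Hodge (§I2, mod c1 + V-B3) and the row on the power `A^{×(a+1)}`
(an abelian variety; companion's `absoluteHodge_algebraic_cartesianPow_of_absoluteHodgeImpliesAlgebraicAV`) makes it algebraic. This is
`(P2) ⟸ ROW ∧ c1` of the companion (`algebraicInvariantsPrincipleAV_of_deligne_of_absoluteHodgeImpliesAlgebraicAV`, there through `HC_AV`)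
re-derived along the absolute road, the intermediate «absolute Hodge» made explicit. [cite: FloccariFu2026, §5 proof of Lemma 5.4 (p. 13)]
[cite: Deligne1982HodgeCycles, Main Thm. 2.11 and I Thm. 3.8] -/
theorem algebraic_of_rational_system_of_algebraicStabilizer_le_of_deligne_of_row
    (hD : deligne1982_hodgeClasses_abelianVariety_absoluteHodge) (hZ : deligne1982_cycleClass_absoluteHodge)
    (hrow : AbsoluteHodgeImpliesAlgebraicAV) (A : AbelianVariety ℂ)
    {S : ∀ a p : ℕ, Set (complexBetti (cartesianPow A.X (a + 1)) (2 * p))}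
    (hS : ∀ a p, ∀ c ∈ S a p, IsRationalClass c) (hle : algebraicStabilizer A.X ≤ powClassStabilizer A.X S) (a p : ℕ) :
    S a p ⊆ {c : complexBetti (cartesianPow A.X (a + 1)) (2 * p) |
      IsAbsoluteHodgeClass (cartesianPowDim A.dim a) (cartesianPow A.X (a + 1)) p c ∧
        c ∈ algebraicClasses (cartesianPow A.X (a + 1)) p} := fun c hc ↦
  have hAH := absoluteHodge_of_rational_system_of_algebraicStabilizer_le_of_deligne hD hZ A hS hle a p hc
  ⟨hAH, absoluteHodge_algebraic_cartesianPow_of_absoluteHodgeImpliesAlgebraicAV hrow A a p c hAH⟩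

end Row

end Summit.HodgeConjecture.HodgeConjecture.Ring2.Hypotheses

end
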